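import Mathlib.CategoryTheory.Limits.Shapes.BinaryProducts
import Mathlib.CategoryTheory.Limits.Shapes.SplitCoequalizer
import Mathlib.CategoryTheory.Limits.Preserves.Shapes.Equalizers
import Literature.AnabelianGeometry.SemiGraphs.ThmA4CechPresentation
import Literature.AnabelianGeometry.SemiGraphs.NotationsConventions
import HarnessLib

/-!
# Semi-graphs of anabelioids, Appendix, Theorem A.4 (existence, Čech route), E2: the Čech
# presentation of `C` along `C[A] ⊆ C` and the extension `Ψ = ψ^*` of a functor out of `C[A]`

Mochizuki, *Semi-graphs of anabelioids*, Publ. RIMS **42** (2006) 221–322, Appendix, Theorem A.4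
(manuscript pp. 82–86) [cite: MochizukiSemiAnbd2006, Thm A.4 pp.82-86]: a morphism of connected
quasi-temperoids `φ : T₁[A₁] → T₂[A₂]` extends to a morphism of temperoids `ψ : T₁ → T₂` with
`ψ^*|_{T₂[A₂]} ≅ φ^*`; print, p. 85 (PRIMS p. 315): "The fact that the resulting functor
`ψ^* : T₂ → T₁` preserves countable colimits (respectively, fibered products) follows by a routine
argument from the fact that `φ^*` preserves countable colimits (respectively, countable colimits and
finite limits)."

Row **A4-∃** of `plan/L3/SUBDAG-SemiAnbd-Cor311.md` (Čech route; cut of abc-iut-w5-d129 03:36Z,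
ruling α20 of abc-iut-L3-lead: E0 abc-iut-w5-d220 `OverPrimeDownwardClosed`, E2-core abc-iut-w4-d081
`ThmA4CechPresentation` (the abstract `CechPresentation`, its `extension`, `extensionIso`,
`extension_preservesColimitsOfShape`), **E2 = this file** (abc-iut-L3-t5), E3/E4 abc-iut-w5-d129).

PURE CATEGORY THEORY (any category `C` with binary products, any object `A`), instantiating the
E2-core at the inclusion `ι : C[A] ⥤ C`:

* `ThmA4Cech.nerveZero A`, `nerveOne A : C ⥤ C[A]` — `X ↦ (X ⨯ A) ⨯ A`, `X ↦ X ⨯ A` (both map to `A`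
  by a projection), and the two projections `fstHom`, `sndHom : nerveZero ⟶ nerveOne`
  (`((x,a),a') ↦ (x,a)`, `((x,a),a') ↦ (x,a')`): the ČECH NERVE of `X ⨯ A → X`, truncated;
* `ThmA4Cech.nerve A : C ⥤ (WalkingParallelPair ⥤ C[A])` — the same as a functorial parallel pair;
* for `B ∈ C[A]` the augmentation `pr₁ : B ⨯ A → B` is a SPLIT coequalizer of the pair (a section is
  `(𝟙, f)` for any `f : B → A`) — `ThmA4Cech.splitCoequalizer` — hence an ABSOLUTE colimit in `C[A]`;
* **`ThmA4Cech.cechPresentation A : CechPresentation (admitsHomTo A).ι`** — the Čech presentation of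
  `C` along `C[A] ⊆ C`;
* **`ThmA4Cech.Ψ A H : C ⥤ C'`** `:= (cechPresentation A).extension H` — for `H = φ^* ⋙ ι₁` this is
  "`ψ^*(X) :=` the coequalizer in `T₁` of `φ^*(X × A₂ × A₂) ⇉ φ^*(X × A₂)`";
* **`ThmA4Cech.α A H : H ≅ (admitsHomTo A).ι ⋙ Ψ A H`** — the 1-commutativity `φ^* ≅ ψ^* ∘ λ₂` of
  Thm. A.4, for EVERY `H` (split coequalizers are preserved by every functor);
* **`ThmA4Cech.preservesColimitsOfShape_Ψ`** — `Ψ A H` preserves the colimits of shape `J` as soon as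
  `C`, `C'` have them, `(− ⨯ A) : C ⥤ C` preserves them and `H` preserves them — the countable-colimit
  clause of "`ψ` is a morphism of temperoids" (for `B^temp(Π)`: `(− ⨯ A)` preserves countable
  colimits, abc-iut-w5-d220's E2a; `φ^*` does by hypothesis; `T₁[A₁] ⊆ T₁` does by E0).

The finite-limit clause (E3: terminal object, pullbacks) and the assembly into the engine binder of
`ThmA4Chart.thmA4_of_engine′` (E4) are companions (abc-iut-w5-d129).  The model specialisation
`C = B^temp(Π₂)`, `A = A₂`, `H = φ^* ⋙ (admitsHomTo A₁).ι` needs no further definition: the Ψ-term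
of record is `ThmA4Cech.Ψ A₂ (F ⋙ (admitsHomTo A₁).ι)`.  Elementary; nothing here refers to the IUT
corpus; no side is taken on any disputed claim.
-/

open CategoryTheory CategoryTheory.Limits

namespace Literature.AnabelianGeometry.SemiGraphs

namespace ThmA4Cech

universe v₁ v₃ u₁ u₃

variable {C : Type u₁} [Category.{v₁} C] [HasBinaryProducts C] (A : C)

/-! ### The truncated Čech nerve of `X ⨯ A → X`, valued in `C[A]` -/

/-- Level one of the nerve: `X ↦ X ⨯ A`, an object of `C[A]` through `pr₂` ("`X × A₂` admits a
morphism to `A₂`"). [cite: MochizukiSemiAnbd2006, Thm A.4 pp.82-86] -/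
noncomputable def nerveOne : C ⥤ Over' A where
  obj X := ⟨X ⨯ A, ⟨prod.snd⟩⟩
  map f := ObjectProperty.homMk (prod.map f (𝟙 A))
  map_id X := by
    apply InducedCategory.hom_ext
    simp only [ObjectProperty.homMk_hom, prod.map_id_id, ObjectProperty.FullSubcategory.id_hom]
  map_comp f g := by
    apply InducedCategory.hom_ext
    simp only [ObjectProperty.homMk_hom, ObjectProperty.FullSubcategory.comp_hom, prod.map_map,
      Category.comp_id]

/-- Level zero of the nerve: `X ↦ (X ⨯ A) ⨯ A` (`= (X ⨯ A) ×_X (X ⨯ A)`), an object of `C[A]`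
through the last projection. [cite: MochizukiSemiAnbd2006, Thm A.4 pp.82-86] -/
noncomputable def nerveZero : C ⥤ Over' A where
  obj X := ⟨(X ⨯ A) ⨯ A, ⟨prod.snd⟩⟩
  map f := ObjectProperty.homMk (prod.map (prod.map f (𝟙 A)) (𝟙 A))
  map_id X := by
    apply InducedCategory.hom_ext
    simp only [ObjectProperty.homMk_hom, prod.map_id_id, ObjectProperty.FullSubcategory.id_hom]
  map_comp f g := by
    apply InducedCategory.hom_ext
    simp only [ObjectProperty.homMk_hom, ObjectProperty.FullSubcategory.comp_hom, prod.map_map,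
      Category.comp_id]

/-- `nerveOne` on objects. [cite: MochizukiSemiAnbd2006, Thm A.4 pp.82-86] -/
@[simp] theorem nerveOne_obj_obj (X : C) : ((nerveOne A).obj X).obj = (X ⨯ A) := rfl

/-- `nerveZero` on objects. [cite: MochizukiSemiAnbd2006, Thm A.4 pp.82-86] -/
@[simp] theorem nerveZero_obj_obj (X : C) : ((nerveZero A).obj X).obj = ((X ⨯ A) ⨯ A) := rfl

/-- `nerveOne` on morphisms: `f ↦ f ⨯ 𝟙_A`. [cite: MochizukiSemiAnbd2006, Thm A.4 pp.82-86] -/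
@[simp] theorem nerveOne_map_hom {X Y : C} (f : X ⟶ Y) :
    ((nerveOne A).map f).hom = prod.map f (𝟙 A) := rfl

/-- `nerveZero` on morphisms: `f ↦ (f ⨯ 𝟙_A) ⨯ 𝟙_A`. [cite: MochizukiSemiAnbd2006, Thm A.4 pp.82-86] -/
@[simp] theorem nerveZero_map_hom {X Y : C} (f : X ⟶ Y) :
    ((nerveZero A).map f).hom = prod.map (prod.map f (𝟙 A)) (𝟙 A) := rfl

/-- Level one composed with the inclusion is the product functor `(− ⨯ A)` (identity components).
[cite: MochizukiSemiAnbd2006, Thm A.4 pp.82-86] -/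
noncomputable def nerveOneι : nerveOne A ⋙ (admitsHomTo A).ι ≅ prod.functor.flip.obj A :=
  NatIso.ofComponents (fun _ => Iso.refl _) fun _ =>
    (Category.comp_id _).trans (Category.id_comp _).symm

/-- Level zero composed with the inclusion is `(− ⨯ A) ⋙ (− ⨯ A)` (identity components).
[cite: MochizukiSemiAnbd2006, Thm A.4 pp.82-86] -/
noncomputable def nerveZeroι :
    nerveZero A ⋙ (admitsHomTo A).ι ≅ prod.functor.flip.obj A ⋙ prod.functor.flip.obj A :=
  NatIso.ofComponents (fun _ => Iso.refl _) fun _ =>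
    (Category.comp_id _).trans (Category.id_comp _).symm

/-- The first face `((x,a),a') ↦ (x,a)`. [cite: MochizukiSemiAnbd2006, Thm A.4 pp.82-86] -/
noncomputable def fstHom : nerveZero A ⟶ nerveOne A where
  app X := ObjectProperty.homMk (prod.fst : (X ⨯ A) ⨯ A ⟶ X ⨯ A)
  naturality X Y f := by
    apply InducedCategory.hom_ext
    change prod.map (prod.map f (𝟙 A)) (𝟙 A) ≫ prod.fst = prod.fst ≫ prod.map f (𝟙 A)
    simp

/-- The second face `((x,a),a') ↦ (x,a')`. [cite: MochizukiSemiAnbd2006, Thm A.4 pp.82-86] -/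
noncomputable def sndHom : nerveZero A ⟶ nerveOne A where
  app X := ObjectProperty.homMk (prod.map prod.fst (𝟙 A) : (X ⨯ A) ⨯ A ⟶ X ⨯ A)
  naturality X Y f := by
    apply InducedCategory.hom_ext
    change prod.map (prod.map f (𝟙 A)) (𝟙 A) ≫ prod.map prod.fst (𝟙 A) =
      prod.map prod.fst (𝟙 A) ≫ prod.map f (𝟙 A)
    simp

/-- `fstHom` componentwise. [cite: MochizukiSemiAnbd2006, Thm A.4 pp.82-86] -/
@[simp] theorem fstHom_app_hom (X : C) :
    ((fstHom A).app X).hom = (prod.fst : (X ⨯ A) ⨯ A ⟶ X ⨯ A) := rfl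

/-- `sndHom` componentwise. [cite: MochizukiSemiAnbd2006, Thm A.4 pp.82-86] -/
@[simp] theorem sndHom_app_hom (X : C) :
    ((sndHom A).app X).hom = (prod.map prod.fst (𝟙 A) : (X ⨯ A) ⨯ A ⟶ X ⨯ A) := rfl

/-- **The Čech nerve as a functorial parallel pair** `X ↦ ((X ⨯ A) ⨯ A ⇉ X ⨯ A)` in `C[A]`.
[cite: MochizukiSemiAnbd2006, Thm A.4 pp.82-86] -/
noncomputable def nerve : C ⥤ (WalkingParallelPair ⥤ Over' A) where
  obj X := parallelPair ((fstHom A).app X) ((sndHom A).app X)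
  map f := parallelPairHom _ _ _ _ ((nerveZero A).map f) ((nerveOne A).map f)
    ((fstHom A).naturality f).symm ((sndHom A).naturality f).symm
  map_id X := by
    ext j
    cases j <;> simp
  map_comp f g := by
    ext j
    cases j <;> simp

/-- The nerve on objects. [cite: MochizukiSemiAnbd2006, Thm A.4 pp.82-86] -/
theorem nerve_obj (X : C) :
    (nerve A).obj X = parallelPair ((fstHom A).app X) ((sndHom A).app X) := rfl

/-- The nerve on morphisms, level zero. [cite: MochizukiSemiAnbd2006, Thm A.4 pp.82-86] -/
@[simp] theorem nerve_map_app_zero {X Y : C} (f : X ⟶ Y) :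
    ((nerve A).map f).app WalkingParallelPair.zero = (nerveZero A).map f := rfl

/-- The nerve on morphisms, level one. [cite: MochizukiSemiAnbd2006, Thm A.4 pp.82-86] -/
@[simp] theorem nerve_map_app_one {X Y : C} (f : X ⟶ Y) :
    ((nerve A).map f).app WalkingParallelPair.one = (nerveOne A).map f := rfl

/-- Level zero of the nerve is `nerveZero` (identity components). [cite: MochizukiSemiAnbd2006, Thm A.4 pp.82-86] -/
noncomputable def nerveEvalZeroIso :
    nerve A ⋙ (evaluation WalkingParallelPair (Over' A)).obj WalkingParallelPair.zero ≅ nerveZero A :=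
  NatIso.ofComponents (fun _ => Iso.refl _) fun _ =>
    (Category.comp_id _).trans (Category.id_comp _).symm

/-- Level one of the nerve is `nerveOne` (identity components). [cite: MochizukiSemiAnbd2006, Thm A.4 pp.82-86] -/
noncomputable def nerveEvalOneIso :
    nerve A ⋙ (evaluation WalkingParallelPair (Over' A)).obj WalkingParallelPair.one ≅ nerveOne A :=
  NatIso.ofComponents (fun _ => Iso.refl _) fun _ =>
    (Category.comp_id _).trans (Category.id_comp _).symm

/-! ### The augmentation `pr₁ : B ⨯ A → B` of an object of `C[A]` is a split coequalizer -/

/-- The augmentation `pr₁ : B ⨯ A → B`, a morphism of `C[A]`. [cite: MochizukiSemiAnbd2006, Thm A.4 pp.82-86] -/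
noncomputable def augHom (B : Over' A) : (nerveOne A).obj B.obj ⟶ B :=
  ObjectProperty.homMk (prod.fst : B.obj ⨯ A ⟶ B.obj)

/-- `augHom` underlies `pr₁`. [cite: MochizukiSemiAnbd2006, Thm A.4 pp.82-86] -/
@[simp] theorem augHom_hom (B : Over' A) : (augHom A B).hom = (prod.fst : B.obj ⨯ A ⟶ B.obj) := rfl

/-- A chosen structure arrow `B → A` of an object `B` of `C[A]` ("admits a morphism to `A`").
[cite: MochizukiSemiAnbd2006, §0 p.6] -/
noncomputable def toA (B : Over' A) : B.obj ⟶ A := B.property.some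

/-- **`pr₁ : B ⨯ A → B` is a SPLIT coequalizer of the two faces**, for `B ∈ C[A]` with structure arrow
`f : B → A` (chosen): right section `σ = (𝟙, f) : B → B ⨯ A`, left section
`σ ⨯ 𝟙_A : B ⨯ A → (B ⨯ A) ⨯ A` (`(b,a) ↦ ((b, f b), a)`). [cite: MochizukiSemiAnbd2006, Thm A.4 pp.82-86] -/
noncomputable def splitCoequalizer (B : Over' A) :
    IsSplitCoequalizer ((fstHom A).app B.obj) ((sndHom A).app B.obj) (augHom A B) where
  rightSection := ObjectProperty.homMk (prod.lift (𝟙 B.obj) (toA A B) : B.obj ⟶ B.obj ⨯ A)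
  leftSection :=
    ObjectProperty.homMk (prod.map (prod.lift (𝟙 B.obj) (toA A B)) (𝟙 A) :
      B.obj ⨯ A ⟶ (B.obj ⨯ A) ⨯ A)
  condition := by
    apply InducedCategory.hom_ext
    change (prod.fst : (B.obj ⨯ A) ⨯ A ⟶ B.obj ⨯ A) ≫ prod.fst = prod.map prod.fst (𝟙 A) ≫ prod.fst
    exact (prod.map_fst _ _).symm
  rightSection_π := by
    apply InducedCategory.hom_ext
    change prod.lift (𝟙 B.obj) (toA A B) ≫ prod.fst = 𝟙 B.obj
    exact prod.lift_fst _ _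
  leftSection_bottom := by
    apply InducedCategory.hom_ext
    change prod.map (prod.lift (𝟙 B.obj) (toA A B)) (𝟙 A) ≫ prod.map prod.fst (𝟙 A) =
      𝟙 (B.obj ⨯ A)
    calc prod.map (prod.lift (𝟙 B.obj) (toA A B)) (𝟙 A) ≫ prod.map prod.fst (𝟙 A)
        = prod.map (prod.lift (𝟙 B.obj) (toA A B) ≫ prod.fst) (𝟙 A ≫ 𝟙 A) := prod.map_map _ _ _ _
      _ = prod.map (𝟙 B.obj) (𝟙 A) := by rw [prod.lift_fst, Category.comp_id]
      _ = 𝟙 (B.obj ⨯ A) := prod.map_id_id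
  leftSection_top := by
    apply InducedCategory.hom_ext
    change prod.map (prod.lift (𝟙 B.obj) (toA A B)) (𝟙 A) ≫ prod.fst =
      prod.fst ≫ prod.lift (𝟙 B.obj) (toA A B)
    exact prod.map_fst _ _

/-- Hence the pair of faces over an object of `C[A]` is a split pair (absolute colimit).
[cite: MochizukiSemiAnbd2006, Thm A.4 pp.82-86] -/
theorem hasSplitCoequalizer (B : Over' A) :
    HasSplitCoequalizer ((fstHom A).app B.obj) ((sndHom A).app B.obj) :=
  ⟨⟨B, augHom A B, ⟨splitCoequalizer A B⟩⟩⟩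

/-- EVERY functor out of `C[A]` preserves the augmented-nerve colimit of an object of `C[A]` (split
coequalizers are absolute). [cite: MochizukiSemiAnbd2006, Thm A.4 pp.82-86] -/
theorem preservesColimit_nerve {C' : Type u₃} [Category.{v₃} C'] (H : Over' A ⥤ C') (B : Over' A) :
    PreservesColimit ((nerve A).obj ((admitsHomTo A).ι.obj B)) H := by
  haveI : HasSplitCoequalizer ((fstHom A).app ((admitsHomTo A).ι.obj B))
      ((sndHom A).app ((admitsHomTo A).ι.obj B)) := hasSplitCoequalizer A B
  exact preservesSplitCoequalizers H _ _

/-! ### The Čech presentation of `C` along `C[A] ⊆ C` -/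

/-- **The Čech presentation of `C` along `ι : C[A] ⥤ C`**: nerve `X ↦ ((X ⨯ A) ⨯ A ⇉ X ⨯ A)`,
augmentation `pr₁`, which is a (split) coequalizer in `C[A]` for every `B ∈ C[A]` — "every object is
the coequalizer of its Čech nerve" (the presentation behind `ψ^*`).
[cite: MochizukiSemiAnbd2006, Thm A.4 pp.82-86] -/
noncomputable def cechPresentation : CechPresentation (admitsHomTo A).ι where
  nerve := nerve A
  cocone B := (splitCoequalizer A B).asCofork.ι
  naturality {B B'} f := by
    ext j
    cases j
    · change prod.map (prod.map f.hom (𝟙 A)) (𝟙 A) ≫ ((prod.fst : (B'.obj ⨯ A) ⨯ A ⟶ B'.obj ⨯ A) ≫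
          prod.fst) = ((prod.fst : (B.obj ⨯ A) ⨯ A ⟶ B.obj ⨯ A) ≫ prod.fst) ≫ f.hom
      simp
    · change prod.map f.hom (𝟙 A) ≫ prod.fst = prod.fst ≫ f.hom
      simp
  isColimit B := (splitCoequalizer A B).isCoequalizer

/-- The presentation's nerve is `nerve A`. [cite: MochizukiSemiAnbd2006, Thm A.4 pp.82-86] -/
@[simp] theorem cechPresentation_nerve : (cechPresentation A).nerve = nerve A := rfl

/-- The presentation's augmentation at level one is `pr₁`. [cite: MochizukiSemiAnbd2006, Thm A.4 pp.82-86] -/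
@[simp] theorem cechPresentation_aug_one (B : Over' A) :
    (cechPresentation A).aug B WalkingParallelPair.one = augHom A B := rfl

/-! ### `Ψ = ψ^*`, the 1-commutativity `α`, and the countable-colimit clause -/

variable {C' : Type u₃} [Category.{v₃} C'] (H : Over' A ⥤ C')
  [HasColimitsOfShape WalkingParallelPair C']

/-- **`Ψ = ψ^* : C ⥤ C'`**, `X ↦ coeq(H((X ⨯ A) ⨯ A) ⇉ H(X ⨯ A))` — for `C = T₂`, `A = A₂`,
`H = φ^* ⋙ (T₁[A₁] ⊆ T₁)`: "`ψ^*(X) :=` the coequalizer in `T₁` of `φ^*(X × A₂ × A₂) ⇉ φ^*(X × A₂)`".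
[cite: MochizukiSemiAnbd2006, Thm A.4 pp.82-86] -/
noncomputable def Ψ : C ⥤ C' := (cechPresentation A).extension H

/-- `Ψ` is the E2-core extension of the Čech presentation. [cite: MochizukiSemiAnbd2006, Thm A.4 pp.82-86] -/
theorem Ψ_def : Ψ A H = (cechPresentation A).extension H := rfl

/-- `Ψ` on objects. [cite: MochizukiSemiAnbd2006, Thm A.4 pp.82-86] -/
theorem Ψ_obj (X : C) : (Ψ A H).obj X = colimit ((nerve A).obj X ⋙ H) := rfl

/-- **The 1-commutativity of Thm. A.4, `α : H ≅ ι ⋙ Ψ`** (`φ^* ≅ ψ^* ∘ λ₂` on `T₂[A₂]`), for EVERY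
functor `H` out of `C[A]`: the presenting colimits are split, hence preserved by `H`.
[cite: MochizukiSemiAnbd2006, Thm A.4 pp.82-86] -/
noncomputable def α : H ≅ (admitsHomTo A).ι ⋙ Ψ A H :=
  ((cechPresentation A).extensionIso H (hH := fun B => preservesColimit_nerve A H B)).symm

/-- The component of `α⁻¹` at `B` on the last colimit injection is `H(pr₁)`.
[cite: MochizukiSemiAnbd2006, Thm A.4 pp.82-86] -/
theorem colimit_ι_α_inv_app (B : Over' A) :
    colimit.ι ((nerve A).obj B.obj ⋙ H) WalkingParallelPair.one ≫ (α A H).inv.app B =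
      H.map (augHom A B) :=
  (cechPresentation A).colimit_ι_extensionIsoApp_hom H (hH := fun B => preservesColimit_nerve A H B)
    B WalkingParallelPair.one

omit [HasColimitsOfShape WalkingParallelPair C'] in
/-- The nerve levels preserve the colimits of shape `J` that `C` has as soon as `(− ⨯ A)` does
(`C[A] ⊆ C` reflects colimits). [cite: MochizukiSemiAnbd2006, Thm A.4 pp.82-86] -/
theorem preservesColimitsOfShape_nerveOne (J : Type*) [Category J]
    [PreservesColimitsOfShape J (prod.functor.flip.obj A)] :
    PreservesColimitsOfShape J (nerveOne A) :=
  haveI : PreservesColimitsOfShape J (nerveOne A ⋙ (admitsHomTo A).ι) :=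
    preservesColimitsOfShape_of_natIso (nerveOneι A).symm
  preservesColimitsOfShape_of_reflects_of_preserves (nerveOne A) (admitsHomTo A).ι

omit [HasColimitsOfShape WalkingParallelPair C'] in
/-- Idem for level zero (`(− ⨯ A)` twice). [cite: MochizukiSemiAnbd2006, Thm A.4 pp.82-86] -/
theorem preservesColimitsOfShape_nerveZero (J : Type*) [Category J]
    [PreservesColimitsOfShape J (prod.functor.flip.obj A)] :
    PreservesColimitsOfShape J (nerveZero A) :=
  haveI : PreservesColimitsOfShape J (nerveZero A ⋙ (admitsHomTo A).ι) :=
    preservesColimitsOfShape_of_natIso (nerveZeroι A).symm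
  preservesColimitsOfShape_of_reflects_of_preserves (nerveZero A) (admitsHomTo A).ι

/-- **`Ψ` preserves the colimits of shape `J`** that `C'` has, as soon as `(− ⨯ A) : C ⥤ C` and `H`
preserve colimits of shape `J` — the countable-colimit clause of "`ψ` is a morphism of temperoids"
(print p. 85: "follows by a routine argument from the fact that `φ^*` preserves countable colimits").
[cite: MochizukiSemiAnbd2006, Thm A.4 pp.82-86] -/
theorem preservesColimitsOfShape_Ψ (J : Type*) [Category J] [HasColimitsOfShape J C']
    [PreservesColimitsOfShape J (prod.functor.flip.obj A)] [PreservesColimitsOfShape J H] :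
    PreservesColimitsOfShape J (Ψ A H) := by
  haveI := preservesColimitsOfShape_nerveOne A J
  haveI := preservesColimitsOfShape_nerveZero A J
  refine (cechPresentation A).extension_preservesColimitsOfShape H J fun j => ?_
  cases j
  · haveI : PreservesColimitsOfShape J
        (nerve A ⋙ (evaluation WalkingParallelPair (Over' A)).obj WalkingParallelPair.zero) :=
      preservesColimitsOfShape_of_natIso (nerveEvalZeroIso A).symm
    change PreservesColimitsOfShape J
      ((nerve A ⋙ (evaluation WalkingParallelPair (Over' A)).obj WalkingParallelPair.zero) ⋙ H)
    infer_instance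
  · haveI : PreservesColimitsOfShape J
        (nerve A ⋙ (evaluation WalkingParallelPair (Over' A)).obj WalkingParallelPair.one) :=
      preservesColimitsOfShape_of_natIso (nerveEvalOneIso A).symm
    change PreservesColimitsOfShape J
      ((nerve A ⋙ (evaluation WalkingParallelPair (Over' A)).obj WalkingParallelPair.one) ⋙ H)
    infer_instance

end ThmA4Cech

end Literature.AnabelianGeometry.SemiGraphs
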